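import Mathlib
import HarnessLib
import Literature.MathematicalPhysics.QuantumLattice.InfraredCutoffGramConstantLargeVolume
import Summits.HubbardSuperconductivity.HubbardSuperconductivity.Theorems.KLProgrammeKLRegimeFrameShellCount
import Summits.HubbardSuperconductivity.HubbardSuperconductivity.Theorems.KLProgrammeKLRegimeEngineV8Defs

/-!
# Route `KLProgramme`, ENGINE child (stmt-…-20437), scale `0`: the determinant / replica-Gram constant of the KL carrier's scale-`0`
# covariance is `√728` — not `√12108` — for every admissible frame, under the engine's OWN volume threshold `klEngL₃ β U ≤ L`

Cell gate-hubbard-kl, seat p1 (g18); brick D2 of the located item #22 «(C)-SCALE0-NATURAL» (memo SCALE0-REMAINDER-BUDGET, evidence on 20437).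
The scale-`0` determinant constant of record is `δ₀² = 2(7 + κ_IR²)` with the infrared Gram constant `κ_IR² ≤ 7c₁Λ + (Λ+8)c₂ = 6047` at
`Λ = e₀ = 1/32`, `(c₁, c₂) = (1793, 704)` (`…FrameShellCount.isDetBoundedR_scaleZero_of_frameOK_sharp`, every `L ≥ β`).  Of the 6047,
`5654 = (Λ+8)c₂` is the finite-volume ROUNDING term `c₂·L` of the level count `#{|e_K| < η} ≤ c₁ηL² + c₂L`, paid through `β ≤ L`.
With the large-volume form of the Pedra–Salmhofer phase-space sum (`Literature/…/InfraredCutoffGramConstantLargeVolume`: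
`Σ ≤ (20/π)c₁ΛβL² + (8/π²)c₂Λβ²L + (24/π)c₂βL`, no relation between `β` and `L`) the rounding terms are `c₂((8/π²)Λβ + 24/π)/L` per
unit `βL²`, i.e. `≤ 10⁻³` once `2¹⁰β² ≤ L` — which the engine's volume threshold `klEngL₃ β U = 2¹⁰(⌈β⌉₊+1)²(⌈|U|⁻¹⌉₊+1)²` implies
(`sq_le_klEngL₃`) — leaving `κ_IR² ≤ (20/π)·1793/32 + 10⁻³ ≤ 357`:

* `infraredGram_frame_le_largeVolume` — the frame-uniform three-term phase-space sum (count discharged by `card_frameLevel_lt_le`);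
* `infraredGram_scaleZero_le_largeL` — `(βL²)⁻¹·Σ ≤ 357` at `Λ = klE0` for `klBetaMin ≤ β`, `2¹⁰β² ≤ L`;
* **`isDetBoundedR_scaleZero_of_frameOK_largeL`** / **`isGramBoundedR_scaleZero_of_frameOK_largeL`** — `IsDetBoundedR q (SᵀC^K_{>e₀}S) √(2·(7+357))`
  and the replica-Gram form, every admissible frame, every `M ≥ 1` (door `isDetBoundedR_gridSub_hubbardCovAboveCT`);
* `sq_le_klEngL₃`, **`isDetBoundedR_scaleZero_of_frameOK_klEngL₃`** / **`isGramBoundedR_scaleZero_of_frameOK_klEngL₃`** — the same under the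
  literal binder `klEngL₃ β U ≤ L` of the engine stubs.

`δ₀² = 728` replaces `12108` (×16.6; `δ₀⁸`: ×7.7·10⁴) wherever a consumer re-keys; no frozen token is touched, nothing here is a definition.
Everything PROVED. [folklore]
-/

noncomputable section

-- the tree's namespace `Summit.<Summit>.<Problem>.Theorems` repeats the summit name by design (D-0017)
set_option linter.dupNamespace false

namespace Summit.HubbardSuperconductivity.HubbardSuperconductivity.Theorems.KLRegimeSplit

open Real Finset Literature.MathematicalPhysics.QuantumLattice Literature.Probability.LatticeModels
open Literature.MathematicalPhysics.QuantumLattice.FermiRG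
open Summit.HubbardSuperconductivity.HubbardSuperconductivity.Theorems.DispersionFlow

variable {L : ℕ} [NeZero L]

/-- **The infrared phase-space sum of an admissible frame, large-volume form** (no `β ≤ L`): for `FrameOK R U N μ K`, `0 < β`,
`π/β ≤ Λ ≤ 3/80`, every `L ≥ 1` and every Matsubara cutoff `M`,
`Σ_{(ω,k⃗)} (1 - w^K_Λ)/√(ω² + e_K²) ≤ (20/π)·1793·Λ·βL² + (8/π²)·704·Λ·β²L + (24/π)·704·βL`. -/
theorem infraredGram_frame_le_largeVolume {M : ℕ} {R : RenConsts} {U : ℝ} {N : ℕ} {μ : ℝ} {K : TrigPolyC4v}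
    (hK : FrameOK R U N μ K) {β Λ : ℝ} (hβ : 0 < β) (hΛ : 0 < Λ) (hΛβ : Real.pi / β ≤ Λ) (hΛr : Λ ≤ 3 / 80) :
    ∑ k : FreqMomentum L M, (1 - hubbardCutoffWeightCT L M β μ K Λ k) /
        Real.sqrt (matsubaraFreq β M k.1 ^ 2 + nambuXiCT L μ K k.2 ^ 2) ≤
      20 / Real.pi * 1793 * Λ * β * (L : ℝ) ^ 2 + 8 / Real.pi ^ 2 * 704 * Λ * β ^ 2 * L + 24 / Real.pi * 704 * β * L :=
  sum_one_sub_hubbardCutoffWeightCT_div_sqrt_le_largeVolume hβ μ K hΛ hΛβ (by norm_num) (by norm_num)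
    fun η hη hηΛ => card_frameLevel_lt_le hK hη (hηΛ.trans hΛr)

/-- **The scale-`0` infrared Gram constant is `≤ 357` once `2¹⁰β² ≤ L`**: for `FrameOK R U N μ K`, `klBetaMin ≤ β`, `2¹⁰·β² ≤ L`, every `M`,
`(βL²)⁻¹ Σ_{(ω,k⃗)} (1 - w^K_{e₀})/√(ω² + e_K²) ≤ 357` (`(20/π)·1793/32 ≤ 356.71`, rounding terms `≤ 10⁻³`). -/
theorem infraredGram_scaleZero_le_largeL {M : ℕ} {R : RenConsts} {U : ℝ} {N : ℕ} {μ : ℝ} {K : TrigPolyC4v}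
    (hK : FrameOK R U N μ K) {β : ℝ} (hβ : klBetaMin ≤ β) (hL : (2 : ℝ) ^ 10 * β ^ 2 ≤ L) :
    1 / (β * (L : ℝ) ^ 2) * ∑ k : FreqMomentum L M,
      (1 - hubbardCutoffWeightCT L M β μ K klE0 k) / Real.sqrt (matsubaraFreq β M k.1 ^ 2 + nambuXiCT L μ K k.2 ^ 2) ≤ 357 := by
  have h128 : (128 : ℝ) ≤ β := by simpa [klBetaMin] using hβ
  have hβpos : 0 < β := by linarith
  have hLpos : (0 : ℝ) < L := by exact_mod_cast Nat.pos_of_ne_zero (NeZero.ne L)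
  have he₀ : (0 : ℝ) < klE0 := by norm_num [klE0]
  have he₀' : klE0 ≤ 3 / 80 := by norm_num [klE0]
  have hπβ : Real.pi / β ≤ klE0 := by
    rw [div_le_iff₀ hβpos, klE0]
    nlinarith [Real.pi_lt_four]
  have hsum := infraredGram_frame_le_largeVolume (L := L) (M := M) hK hβpos he₀ hπβ he₀'
  have hβL2 : 0 < β * (L : ℝ) ^ 2 := by positivity
  rw [one_div, inv_mul_le_iff₀ hβL2]
  refine hsum.trans ?_
  -- numerics: `q = π⁻¹ ≤ 0.31831`
  set q : ℝ := Real.pi⁻¹ with hq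
  have hπ := Real.pi_gt_d6
  have hq0 : 0 < q := by rw [hq]; exact inv_pos.2 Real.pi_pos
  have hq1 : q ≤ 0.31831 := by
    rw [hq, inv_le_comm₀ Real.pi_pos (by norm_num)]
    have : (1 : ℝ) / 0.31831 ≤ 3.141592 := by norm_num
    rw [one_div] at this
    linarith
  have e1 : 20 / Real.pi * 1793 * klE0 * β * (L : ℝ) ^ 2 + 8 / Real.pi ^ 2 * 704 * klE0 * β ^ 2 * L + 24 / Real.pi * 704 * β * L =
      (20 * 1793 / 32) * q * (β * (L : ℝ) ^ 2) + (8 * 704 / 32) * q ^ 2 * β * (β * L) + (24 * 704) * q * (β * L) := by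
    simp only [hq, klE0, div_eq_mul_inv]
    ring
  rw [e1]
  -- the three coefficients
  have c1 : (20 * 1793 / 32 : ℝ) * q ≤ 356.71 := by nlinarith
  have c2 : (8 * 704 / 32 : ℝ) * q ^ 2 ≤ 17.84 := by nlinarith
  have c3 : (24 * 704 : ℝ) * q ≤ 5378.2 := by nlinarith
  have hβL : 0 < β * (L : ℝ) := by positivity
  have t1 : (20 * 1793 / 32 : ℝ) * q * (β * (L : ℝ) ^ 2) ≤ 356.71 * (β * (L : ℝ) ^ 2) :=
    mul_le_mul_of_nonneg_right c1 hβL2.le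
  have t2 : (8 * 704 / 32 : ℝ) * q ^ 2 * β * (β * L) ≤ 17.84 * β * (β * L) := by
    have := mul_le_mul_of_nonneg_right c2 (mul_nonneg hβpos.le hβL.le)
    nlinarith
  have t3 : (24 * 704 : ℝ) * q * (β * L) ≤ 5378.2 * (β * L) := mul_le_mul_of_nonneg_right c3 hβL.le
  -- the rounding terms against the slack `0.29·βL²`, using `L ≥ 2¹⁰β² ≥ 2¹⁰·128·β`
  have hLβ : (2 : ℝ) ^ 10 * 128 * β ≤ L := by nlinarith
  have hslack : 17.84 * β * (β * L) + 5378.2 * (β * L) ≤ 0.29 * (β * (L : ℝ) ^ 2) := by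
    have h1 : 17.84 * β + 5378.2 ≤ 0.29 * (L : ℝ) := by nlinarith
    have h2 : 17.84 * β * (β * L) + 5378.2 * (β * L) = (17.84 * β + 5378.2) * (β * L) := by ring
    have h3 : 0.29 * (β * (L : ℝ) ^ 2) = (0.29 * L) * (β * L) := by ring
    rw [h2, h3]
    exact mul_le_mul_of_nonneg_right h1 hβL.le
  linarith

/-- **The scale-`0` covariance of the KL carrier is determinant-bounded with `δ₀ = √(2·(7 + 357)) = √728 ≈ 27` for every admissible frame
once `2¹⁰β² ≤ L`** (the large-volume twin of `isDetBoundedR_scaleZero_of_frameOK_sharp`, whose `δ₀ = √12108` holds for every `L ≥ β`): for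
`FrameOK R U N μ K`, `klBetaMin ≤ β`, `2¹⁰·β² ≤ L` and every Matsubara cutoff `M ≥ 1`,
`IsDetBoundedR q ((hubbardGridSub L M β (4M))ᵀ · hubbardCovAboveCT L M β μ 0 K e₀ · hubbardGridSub L M β (4M)) √728`. -/
theorem isDetBoundedR_scaleZero_of_frameOK_largeL {R : RenConsts} {U : ℝ} {N : ℕ} {μ : ℝ} {K : TrigPolyC4v}
    (hK : FrameOK R U N μ K) {β : ℝ} (hβ : klBetaMin ≤ β) {M : ℕ} [NeZero M] (hL : (2 : ℝ) ^ 10 * β ^ 2 ≤ L) :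
    IsDetBoundedR (fun X : GridLeg (GridPoint L (2 * (2 * M))) => decide (X.2 = 0))
      ((hubbardGridSub L M β (2 * (2 * M))).transpose * hubbardCovAboveCT L M β μ 0 K klE0 *
        hubbardGridSub L M β (2 * (2 * M)))
      (Real.sqrt (2 * (7 + 357))) := by
  have hβpos : 0 < β := lt_of_lt_of_le (by norm_num [klBetaMin]) hβ
  have hκ : 1 / (β * (L : ℝ) ^ 2) * ∑ k : FreqMomentum L M,
      (1 - hubbardCutoffWeightCT L M β μ K klE0 k) / Real.sqrt (matsubaraFreq β M k.1 ^ 2 + nambuXiCT L μ K k.2 ^ 2) ≤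
        (Real.sqrt 357) ^ 2 := by
    rw [Real.sq_sqrt (by norm_num)]
    exact infraredGram_scaleZero_le_largeL (L := L) (M := M) hK hβ hL
  have h := isDetBoundedR_gridSub_hubbardCovAboveCT (L := L) (M := M) hβpos μ K klE0 hκ
  rwa [Real.sq_sqrt (by norm_num)] at h

/-- **The scale-`0` covariance of the KL carrier is replica-Gram-bounded with `√(2·(7 + 357)) = √728` for every admissible frame once
`2¹⁰β² ≤ L`** — the form consumed by `GrassmannEffectiveActionBoundDB.sum_norm_kernel_effAction_le_of_gramBounded` and the weighted truncation
lemmas; `M`-uniform. -/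
theorem isGramBoundedR_scaleZero_of_frameOK_largeL {R : RenConsts} {U : ℝ} {N : ℕ} {μ : ℝ} {K : TrigPolyC4v}
    (hK : FrameOK R U N μ K) {β : ℝ} (hβ : klBetaMin ≤ β) {M : ℕ} [NeZero M] (hL : (2 : ℝ) ^ 10 * β ^ 2 ≤ L) :
    IsGramBoundedR
      ((hubbardGridSub L M β (2 * (2 * M))).transpose * hubbardCovAboveCT L M β μ 0 K klE0 *
        hubbardGridSub L M β (2 * (2 * M)))
      (Real.sqrt (2 * (7 + 357))) :=
  (isDetBoundedR_scaleZero_of_frameOK_largeL (L := L) hK hβ hL).isGramBoundedR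
    (fun _ _ h => EngineV8.gridSub_hubbardCovAboveCT_apply_of_charge_eq β μ K klE0 (2 * (2 * M)) h) (Real.sqrt_nonneg _)

/-! ## Under the engine's literal volume binder `klEngL₃ β U ≤ L` -/

/-- `2¹⁰·β² ≤ klEngL₃ β U` (`klEngL₃ β U = 2¹⁰(⌈|β|⌉₊+1)²(⌈|U|⁻¹⌉₊+1)²`). -/
theorem sq_le_klEngL₃ (β U : ℝ) : (2 : ℝ) ^ 10 * β ^ 2 ≤ (EngineV8.klEngL₃ β U : ℝ) := by
  unfold EngineV8.klEngL₃
  push_cast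
  have h1 : |β| ≤ (⌈|β|⌉₊ : ℝ) := Nat.le_ceil _
  have h2 : β ^ 2 ≤ ((⌈|β|⌉₊ : ℝ) + 1) ^ 2 := by
    have hb : |β| ≤ (⌈|β|⌉₊ : ℝ) + 1 := by linarith
    calc β ^ 2 = |β| ^ 2 := (sq_abs β).symm
      _ ≤ ((⌈|β|⌉₊ : ℝ) + 1) ^ 2 := pow_le_pow_left₀ (abs_nonneg β) hb 2
  have h3 : (1 : ℝ) ≤ ((⌈|U|⁻¹⌉₊ : ℝ) + 1) ^ 2 := by
    have : (1 : ℝ) ≤ (⌈|U|⁻¹⌉₊ : ℝ) + 1 := by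
      have := Nat.cast_nonneg (α := ℝ) ⌈|U|⁻¹⌉₊
      linarith
    nlinarith
  calc (2 : ℝ) ^ 10 * β ^ 2 = 2 ^ 10 * β ^ 2 * 1 := by ring
    _ ≤ 2 ^ 10 * ((⌈|β|⌉₊ : ℝ) + 1) ^ 2 * ((⌈|U|⁻¹⌉₊ : ℝ) + 1) ^ 2 := by
        gcongr
    _ = 1024 * ((⌈|β|⌉₊ : ℝ) + 1) ^ 2 * ((⌈|U|⁻¹⌉₊ : ℝ) + 1) ^ 2 := by norm_num

omit [NeZero L] in
/-- `klEngL₃ β U ≤ L ⇒ 2¹⁰·β² ≤ L`. -/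
theorem sq_le_of_klEngL₃_le {β U : ℝ} (hL : EngineV8.klEngL₃ β U ≤ L) : (2 : ℝ) ^ 10 * β ^ 2 ≤ L :=
  (sq_le_klEngL₃ β U).trans (by exact_mod_cast hL)

/-- **`δ₀ = √728` under the engine stub's own binders**: `FrameOK R U N μ K`, `klBetaMin ≤ β`, `klEngL₃ β U ≤ L`, every `M ≥ 1` ⇒
`IsDetBoundedR q (Sᵀ·C^K_{>e₀}·S) √(2·(7+357))`. -/
theorem isDetBoundedR_scaleZero_of_frameOK_klEngL₃ {R : RenConsts} {U : ℝ} {N : ℕ} {μ : ℝ} {K : TrigPolyC4v}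
    (hK : FrameOK R U N μ K) {β : ℝ} (hβ : klBetaMin ≤ β) {M : ℕ} [NeZero M] (hL : EngineV8.klEngL₃ β U ≤ L) :
    IsDetBoundedR (fun X : GridLeg (GridPoint L (2 * (2 * M))) => decide (X.2 = 0))
      ((hubbardGridSub L M β (2 * (2 * M))).transpose * hubbardCovAboveCT L M β μ 0 K klE0 *
        hubbardGridSub L M β (2 * (2 * M)))
      (Real.sqrt (2 * (7 + 357))) :=
  isDetBoundedR_scaleZero_of_frameOK_largeL hK hβ (sq_le_of_klEngL₃_le hL)

/-- **Replica-Gram form under the engine stub's own binders** (`klEngL₃ β U ≤ L`): `IsGramBoundedR (Sᵀ·C^K_{>e₀}·S) √(2·(7+357))`. -/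
theorem isGramBoundedR_scaleZero_of_frameOK_klEngL₃ {R : RenConsts} {U : ℝ} {N : ℕ} {μ : ℝ} {K : TrigPolyC4v}
    (hK : FrameOK R U N μ K) {β : ℝ} (hβ : klBetaMin ≤ β) {M : ℕ} [NeZero M] (hL : EngineV8.klEngL₃ β U ≤ L) :
    IsGramBoundedR
      ((hubbardGridSub L M β (2 * (2 * M))).transpose * hubbardCovAboveCT L M β μ 0 K klE0 *
        hubbardGridSub L M β (2 * (2 * M)))
      (Real.sqrt (2 * (7 + 357))) :=
  isGramBoundedR_scaleZero_of_frameOK_largeL hK hβ (sq_le_of_klEngL₃_le hL)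

end Summit.HubbardSuperconductivity.HubbardSuperconductivity.Theorems.KLRegimeSplit

end
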